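import Summits.BirchSwinnertonDyer.BirchSwinnertonDyer.Theorems.KolyvaginRankRigidityAtTwoCorankOneDefs
import Summits.BirchSwinnertonDyer.BirchSwinnertonDyer.Theorems.KolyvaginRankRigidityAtTwoKolyvaginBoundedDefectAtTwoDepthZero
import HarnessLib

/-!
# Crux U1 `KolyvaginBoundedDefectAtTwo` (stmt-BirchSwinnertonDyer-28083), route `KolyvaginRankRigidityAtTwo` — THE CORANK-ONE COLLAPSE,
# kernel-checked under `Theorems/` (helper, `--supports stmt-BirchSwinnertonDyer-28083`; width seat `bsd-line-krr2-p2` g20)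

The route's deciding theorem `Theses.KolyvaginRankRigidityAtTwo.closes` (rev 35) instantiates V1′∞ = U1 + U2 ONLY on Heegner frames with
`corank_{ℤ₂} Sel_{2^∞}(E/ℚ) + corank_{ℤ₂} Sel_{2^∞}(E^{(d_K)}/ℚ) = 1` (its `r = 0` branch books `0 + 1` from a BFH twist with a simple zero and
Gross–Zagier–Kolyvagin; its `r = 1` branch books `1 + 0` from a Hoffstein–Luo twist and Kato), and it uses V2♭∞ (Kolyvagin's structure theorem at
`2`, `KolyvaginCorankLowerBoundAtTwoRich`) ONLY to force the least rich depth to be `ν = 0`, after which the bottom class `c_M(1) ≠ 0` reads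
`ord_{s=1} L(E/K, s) = 1` through Gross–Zagier.  This file proves, sorry-free (pen bsd-idea-1 g19's sketch
`Cruxes/KolyvaginBoundedDefectAtTwo/TwistCongruenceCorankOneSketch.lean` v2, critic idea-crit-5 #364b, re-cut and SHARPENED here):

* `corankOne_of_boundedDefect` : U1 → U1|c1 and `strongCorankOne_of_strong` : V1′∞ → V1|c1 (trivial restrictions);
* `corankOne_of_heegnerNonTorsion` : HNT|c1 → U1|c1 — on corank-one frames U1 follows AT DEPTH `r = 0` from «`y_K` non-torsion» by the landed
  rung `KolyvaginAtTwo.boundedDefectAtTwo_of_nonTorsion` (no swap, no congruence, no Kolyvagin-system bound);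
* `strongCorankOne_of_boundedDefectCorankOne` : U1|c1 → U2 → V1|c1 (LINE 14's glue `StrongNonzeroSystemOfSeedTransport` restricted);
* `heegnerNonTorsion_of_strongCorankOne` : V1|c1 → V2♭∞ → HNT|c1 (NEW: the structure theorem forces `ν = 0`, and a non-zero `c_M(1)` makes
  `P(1) = y_K` non-torsion — Gross 1991 Prop. 4.7 (1), tree `heegnerSystem_kolyvaginClass_eq_zero_of_isOfFinAddOrder`; NO Gross–Zagier);
  so on corank-one frames **HNT|c1 ⟹ U1|c1 ⟹ (U2) V1|c1 ⟹ (V2♭∞) HNT|c1**: the route's Kolyvagin organ and the 2-converse over `K` are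
  interchangeable there modulo the two items U2 / V2♭∞ (both landed modulo Gross 1991 Prop. 3.7 (2));
* `nonCMTwoConverse_of_heegnerNonTorsionCorankOne` (NEW SHARPENING): **HNT|c1 + the off-habitat residual `OffHabitatNonSurjTwoConverse` + the
  route's printed inputs ⟹ the leaf `Rank1Residual.NonCMTwoConverse`, with NEITHER U2 NOR V2♭∞** — hence with NO use of Gross 1991
  Prop. 3.7 (2) (`GrossLMS1991.prop37_2_frobeniusCongruence`, the Eichler–Shimura wall, item 23091) on the habitat branch: `closes` replayed with
  the V1/V2 block replaced by «HNT|c1 gives `y_K` non-torsion, Gross–Zagier (`PrintedInputsRankOneAtTwo`'s `analyticRankEK_eq_one_iff_heegner_nonTorsion`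
  + Shimura reciprocity at conductor `1`) gives `ord_{s=1} L(E/K, s) = 1`»;
* `closes_of_corankOne` : V1|c1 → V2♭∞ → (the other nine hypotheses of `closes`) → leaf, and `nonCMTwoConverse_of_boundedDefectCorankOne` :
  U1|c1 → U2 → V2♭∞ → … → leaf — `closes` needs U1 / V1′∞ only on corank-one frames.

READING (route-shape information for the planner / director ruling #355b; nothing is decided here): for `closes`, U1 (stmt-28083) may be replaced
by U1|c1, and U1|c1 ⟸ HNT|c1 at depth 0; given HNT|c1 the habitat branch needs no Kolyvagin-system machinery and no P372 at all.  U1's surplus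
over U1|c1 (corank `≥ 3` frames: Kolyvagin's conjecture at `2` with bounded defect, LINE 17 / S0ʳ) is OFF the critical path of `closes`.
HONEST FRAMING: every theorem here is an implication between OPEN statements (`@[conjecture]` nodes U1|c1 / HNT|c1 / V1|c1 of
`…CorankOneDefs`, route items by name) plus print-fact hypotheses; the audit block records `proof.conditional`; U1, HNT|c1 (the rank-one
2-converse over `K`, beyond print at `p = 2`), the leaf `NonCMTwoConverse` and rung S3 are NOT proved; nothing closes; **BSD is NOT proved.**
References (locators only): [cite: Kolyvagin1991MathAnn, §2 (2.1), Conj. 2.5, Thm. 2.2] [cite: GrossZagier1986, Thm. I.6.3 with V.§2]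
[cite: GrossLMS1991, §4 (4.1), Prop. 4.7 (1)] [cite: WZhang2014, Thm. 1.1, proof of Thm. 1.3 (p. 196)] [cite: McCallumLMS1991, §5 Prop. 5.2].
Design: no definitions; axioms `propext`, `Classical.choice`, `Quot.sound`.
-/

set_option autoImplicit false
-- the Theorems namespace of this sub repeats the summit name by design (D-0017 nested layout)
set_option linter.dupNamespace false

open scoped Classical

namespace Summit.BirchSwinnertonDyer.BirchSwinnertonDyer.Theorems.KolyvaginAtTwo.CorankOne

open WeierstrassCurve Field Literature.NumberTheory.EllipticCurves
open Summit.BirchSwinnertonDyer.BirchSwinnertonDyer.Theses.KolyvaginRankRigidityAtTwo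

/-! ## §1 Restrictions and the depth-zero door -/

/-- Trivial weakening: U1 (`KolyvaginBoundedDefectAtTwo`, stmt-28083) implies its corank-one restriction. [cite: Kolyvagin1991MathAnn, §2 (2.1), Conj. 2.5] -/
theorem corankOne_of_boundedDefect (hU1 : KolyvaginBoundedDefectAtTwo) : KolyvaginBoundedDefectAtTwoCorankOne :=
  fun W _ _ hCM hred hsur K _ _ hK _ hHN hodd hne3 htor hH2 Dt β ι hβ _ _ ↦
    hU1 W hCM hred hsur K hK hHN hodd hne3 htor hH2 Dt β ι hβ

/-- Trivial weakening: V1′∞ (`KolyvaginStrongNonzeroSystemAtTwo`, stmt-27983) implies its corank-one restriction.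
[cite: Kolyvagin1991MathAnn, §2 (2.1), Conj. 2.5] -/
theorem strongCorankOne_of_strong (hV1 : KolyvaginStrongNonzeroSystemAtTwo) : KolyvaginStrongNonzeroSystemAtTwoCorankOne :=
  fun W _ _ hCM hred hsur K _ _ hK _ hHN hodd hne3 htor hH2 Dt β ι hβ _ _ ↦
    hV1 W hCM hred hsur K hK hHN hodd hne3 htor hH2 Dt β ι hβ

/-- **Corank-one collapse, depth-zero door (pen bsd-idea-1 g19).** On the corank-one frames U1 follows from the non-torsion of `P(1) = y_K`
AT DEPTH `r = 0`, by the landed rung `KolyvaginAtTwo.boundedDefectAtTwo_of_nonTorsion` (McCallum's order formula for `c_M(1)`).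
[cite: McCallumLMS1991, §5, proof of Prop. 5.2 (p. 305)] [cite: Kolyvagin1991MathAnn, §2] -/
theorem corankOne_of_heegnerNonTorsion (h : HeegnerNonTorsionAtTwoCorankOne) : KolyvaginBoundedDefectAtTwoCorankOne :=
  fun W _ _ hCM hred hsur K _ _ hK _ hHN hodd hne3 htor hH2 Dt β ι hβ _ hc ↦
    KolyvaginAtTwo.boundedDefectAtTwo_of_nonTorsion W hCM hred hsur K hK hHN hodd hne3 htor hH2 Dt β ι hβ
      (h W hCM hred hsur K hK hHN hodd hne3 htor hH2 Dt β ι hβ hc)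

/-- **LINE 14's glue restricted to corank-one frames**: U1|c1 + U2 (`FullClassDeepeningAtTwo`, stmt-28084, landed modulo Gross 1991
Prop. 3.7 (2)) ⟹ V1|c1 — the same six lines as `KolyvaginRigidity.strongNonzeroSystemOfSeedTransport_proof` (level `M := c·(m+r+1)+m+1`).
[cite: Kolyvagin1991MathAnn, §2 (2.1)] -/
theorem strongCorankOne_of_boundedDefectCorankOne (h₁ : KolyvaginBoundedDefectAtTwoCorankOne) (h₂ : FullClassDeepeningAtTwo) :
    KolyvaginStrongNonzeroSystemAtTwoCorankOne := by
  intro W _ _ hCM hred hsur K _ _ hK _ hHN hodd hne3 htor hH2 Dt β ι hβ _ hcork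
  obtain ⟨c, hc⟩ := h₂ W hCM hred hsur K hK hHN hodd hne3 htor hH2 Dt β ι hβ
  obtain ⟨r, m, hrm⟩ := h₁ W hCM hred hsur K hK hHN hodd hne3 htor hH2 Dt β ι hβ hcork
  refine ⟨r, fun θ k ↦ ?_⟩
  obtain ⟨n, d, hn, hr, hlev, hne⟩ := hrm (c * (m + r + 1) + m + 1) (by omega)
  exact hc θ k r m (c * (m + r + 1) + m + 1) n d hn hr hlev (by omega) hne

/-! ## §2 The structure theorem closes the cycle: V1|c1 + V2♭∞ ⟹ HNT|c1 (no Gross–Zagier) -/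

/-- **V1|c1 + V2♭∞ ⟹ HNT|c1.**  On a corank-one frame take the least RICH depth `ν` of the strong system (`Nat.find`); Kolyvagin's structure
theorem at `2` in corank form (`KolyvaginCorankLowerBoundAtTwoRich`, stmt-27984: `ν + 1 ≤ corank(E/ℚ)` or `ν + 1 ≤ corank(E^{(d_K)}/ℚ)`) and the
booked equation `corank(E/ℚ) + corank(E^{(d_K)}/ℚ) = 1` force `ν = 0`, so some bottom class `c_M(1) ≠ 0`; a torsion `P(1)` has vanishing
classes (Gross 1991 Prop. 4.7 (1), tree `heegnerSystem_kolyvaginClass_eq_zero_of_isOfFinAddOrder`), hence `P(1) = y_K` has infinite order.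
NO Gross–Zagier input is used. [cite: Kolyvagin1991MathAnn, §2, Thm. 2.2] [cite: GrossLMS1991, Prop. 4.7 (1)] [cite: WZhang2014, proof of Thm. 1.3 (p. 196)] -/
theorem heegnerNonTorsion_of_strongCorankOne (hV1 : KolyvaginStrongNonzeroSystemAtTwoCorankOne) (hV2 : KolyvaginCorankLowerBoundAtTwoRich) :
    HeegnerNonTorsionAtTwoCorankOne := by
  intro W _ _ hCM hred hsur K _ _ hK _ hHN hodd hne3 htor hH2 Dt β ι hβ _ hcork
  have hne4 : NumberField.discr K ≠ -4 := fun h ↦ by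
    rw [h, Int.odd_iff] at hodd; omega
  have h2d : ¬ ((2 : ℤ) ∣ NumberField.discr K) := fun h ↦ by
    rw [Int.odd_iff] at hodd; omega
  obtain ⟨r, hr⟩ := hV1 W hCM hred hsur K hK hHN hodd hne3 htor hH2 Dt β ι hβ hcork
  -- the least RICH depth `ν ≤ r`
  have hex : ∃ ν : ℕ, ∀ θ k : ℕ, ∃ (n : ℕ) (d : KolyvaginHeegnerData Dt β ι n) (M : ℕ),
      KolyvaginDescent.KolSupp (Zhang2014.IsKolyvaginPrime (W.conductorNorm ℤ) W K 2) n ∧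
      n.primeFactors.card = ν ∧ 1 ≤ M ∧ ((θ * M + k : ℕ) : ℕ∞) ≤ Zhang2014.levelIndex W 2 n ∧
      d.kolyvaginClass Nat.prime_two M ≠ 0 := ⟨r, hr⟩
  have hrich := Nat.find_spec hex
  have hbelow : ∀ ν' : ℕ, ν' < Nat.find hex → ∃ θ k : ℕ, ∀ (n' : ℕ) (d' : KolyvaginHeegnerData Dt β ι n') (M' : ℕ),
      KolyvaginDescent.KolSupp (Zhang2014.IsKolyvaginPrime (W.conductorNorm ℤ) W K 2) n' → 1 ≤ M' →
      ((θ * M' + k : ℕ) : ℕ∞) ≤ Zhang2014.levelIndex W 2 n' → n'.primeFactors.card = ν' →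
      d'.kolyvaginClass Nat.prime_two M' = 0 := by
    intro ν' hν'
    have h := Nat.find_min hex hν'
    rw [not_forall] at h
    obtain ⟨θ, h⟩ := h
    rw [not_forall] at h
    obtain ⟨k, hθk⟩ := h
    exact ⟨θ, k, fun n' d' M' hn' hM' hle hcard ↦ by
      by_contra hne'; exact hθk ⟨n', d', M', hn', hcard, hM', hle, hne'⟩⟩
  -- the structure theorem: `ν + 1 ≤ corank(E/ℚ)` or `ν + 1 ≤ corank(E^{(d_K)}/ℚ)`; with the corank-one equation, `ν = 0`
  have hstruct := hV2 W hCM hred hsur K hK hne3 hne4 h2d hHN Dt β ι (Nat.find hex) hrich hbelow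
  have hν : Nat.find hex = 0 := by
    rcases hstruct with h1 | h1 <;> omega
  rw [hν] at hrich
  obtain ⟨n₀, d₀, M₀, hn₀, hν0, -, -, hne₀⟩ := hrich 0 0
  have hn1 : n₀ = 1 := by
    rw [Finset.card_eq_zero, Nat.primeFactors_eq_empty] at hν0
    rcases hν0 with h0 | h1
    · exact absurd (h0 ▸ hn₀.1) not_squarefree_zero
    · exact h1
  subst hn1
  exact ⟨d₀, fun hfin ↦ hne₀ (heegnerSystem_kolyvaginClass_eq_zero_of_isOfFinAddOrder d₀ Nat.prime_two M₀ hfin)⟩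

/-! ## §3 Gross–Zagier reads the analytic rank over `K` from a non-torsion `P(1)` -/

/-- **`P(1) = y_K` non-torsion ⟹ `ord_{s=1} L(E/K, s) = 1`** (Gross–Zagier 1986 Thm. I.6.3 with Kolyvagin, via Gross 1991 §4 `P_1 = y_K`),
granted the Gross–Zagier corollary `analyticRankEK_eq_one_iff_heegner_nonTorsion W N K` (`hGZ`) and Shimura reciprocity at conductor `1`
(`hrec`): `P(1)` descends to a Heegner point `P₀ ∈ E(K)` of level `N` (`heegnerSystem_exists_isHeegnerPoint_map_eq_derivedPoint_one`); `P₀` is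
non-torsion since its image `P(1)` is, and `hGZ` converts.  [cite: GrossZagier1986, Thm. I.6.3 with V.§2] [cite: GrossLMS1991, §4 (4.1)] -/
theorem analyticRankEK_eq_one_of_not_isOfFinAddOrder_derivedPoint_one {N : ℕ} [NeZero N] {W : WeierstrassCurve ℚ} [W.IsElliptic]
    [W.IsGloballyMinimal] {K : Type} [Field K] [NumberField K] {Dt : ModularForms.ModularParametrizationData W N} {β : ℤ} {ι : K →+* ℂ}
    (hGZ : analyticRankEK_eq_one_iff_heegner_nonTorsion W N K) (hrec : heegnerPointOfConductor_one_galoisConj N W K)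
    (hK : IsImaginaryQuadratic K) (hN : W.conductorNorm ℤ = N) (hH : SatisfiesHeegnerHypothesis N K) (d : KolyvaginHeegnerData Dt β ι 1)
    (hd : ¬ IsOfFinAddOrder d.derivedPoint) : analyticRankEK W K = 1 := by
  obtain ⟨P₀, hheeg, hP₀⟩ := heegnerSystem_exists_isHeegnerPoint_map_eq_derivedPoint_one hrec hK hH d
  refine (hGZ hK hN hH hheeg).mpr fun htors ↦ hd ?_
  rw [← hP₀]
  exact (WeierstrassCurve.Affine.Point.map (W' := W) (algebraMap K (ringClassField K ι 1)).toRatAlgHom).isOfFinAddOrder htors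

/-! ## §4 The leaf from HNT|c1 WITHOUT U2 / V2♭∞ (hence without Gross 1991 Prop. 3.7 (2) on the habitat branch) -/

section ClosesReplay

open scoped BigOperators Topology
open Literature

/-- **The leaf `NonCMTwoConverse` from HNT|c1, the off-habitat residual and the printed inputs — NO U2, NO V2♭∞, NO P372 on the habitat.**
Replay of `Theses.KolyvaginRankRigidityAtTwo.closes` (rev 35): off the habitat, `hR`; on it, `r = 0`: 2-parity gives `w(E) = +1`, BFH a Heegner
field `K` (2 split, `d_K ≡ 1 (8)`-type congruence) whose twist has a simple zero, Gross–Zagier–Kolyvagin over `ℚ` books `corank(E^{(d_K)}) = 1`,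
so the frame is corank-one (`0 + 1`), HNT|c1 gives `y_K` non-torsion, Gross–Zagier over `K` gives `r_an(E/K) = 1 = r_an(E) + 1`; `r = 1`:
`w(E) = −1`, Hoffstein–Luo a Heegner field with `L(E^{(d_K)}, 1) ≠ 0`, Kato books `corank(E^{(d_K)}) = 0` (`1 + 0`), HNT|c1 and Gross–Zagier give
`r_an(E/K) = 1 = r_an(E) + 0`.  CONDITIONAL on the OPEN `HeegnerNonTorsionAtTwoCorankOne` and the open/printed route hypotheses; closes nothing.
[cite: GrossZagier1986, Thm. I.6.3 with V.§2, I (6.1)] [cite: Kolyvagin1991MathAnn, §2] [cite: GrossLMS1991, §4 (4.1)] -/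
theorem nonCMTwoConverse_of_heegnerNonTorsionCorankOne (hY : HeegnerNonTorsionAtTwoCorankOne)
    (hR : OffHabitatNonSurjTwoConverse) (hIn : PrintedInputsRankOneAtTwo) (hT : NoTwoTorsionOverK)
    (hf : BFHTwistSupply) (h0 : SimpleZeroTwistSplitAtTwoOfBFH) (hGZK : MultPublishedInputsAtTwo)
    (hMod : NewformOfEllipticCurve) (hHLT : HoffsteinLuoNonvanishingTwist) (hEnt : EntireLFunctionRat) :
    Summit.BirchSwinnertonDyer.BirchSwinnertonDyer.Rank1Residual.NonCMTwoConverse := by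
  have hBFH : SimpleZeroTwistSplitAtTwo := h0 hf
  intro W _ _ hCM hred r hr hc
  by_cases hsur : (∀ m : ℕ, W.HasSurjectiveModNGaloisRep (2 ^ m : ℕ))
  swap
  · exact hR W hCM hred r hr hc hsur
  obtain ⟨-, -, hpar, hKato, -, hGZ, hrec⟩ := hIn
  have hmod : Literature.NumberTheory.EllipticCurves.ModularForms.exists_isNewformOf := hMod
  have hHL : Literature.NumberTheory.EllipticCurves.HoffsteinLuo1997_exists_twist_L_one_ne_zero := hHLT
  have hE : WeierstrassCurve.hasEntireLFunction_rat := hEnt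
  have hGZK' : Literature.NumberTheory.EllipticCurves.rank_eq_analyticRank_of_analyticRank_le_one := hGZK
  haveI : Fact (Nat.Prime 2) := ⟨Nat.prime_two⟩
  haveI : NeZero (W.conductorNorm ℤ) := ⟨(W.conductorNorm_pos_holds).ne'⟩
  obtain rfl | rfl : r = 0 ∨ r = 1 := by omega
  · -- ===== r = 0 : partner twist with a simple zero (BFH 1990 (i), `2` split) =====
    have hw : W.rootNumber = 1 := by
      have h := hpar W
      unfold Literature.NumberTheory.EllipticCurves.p_parity at h
      rw [hc, pow_zero] at h
      exact h.symm
    obtain ⟨K, _, _, hK, -, hHN, hH2, hd8, hL0, hL1⟩ := hBFH W hw 0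
    have hodd : Odd (NumberField.discr K) := by
      rw [Int.odd_iff]; omega
    have hne3 : NumberField.discr K ≠ -3 := by omega
    have hd : (NumberField.discr K : ℚ) ≠ 0 := by exact_mod_cast NumberField.discr_ne_zero K
    haveI := W.isElliptic_quadraticTwist hd
    have hr1 : (W.quadraticTwist (NumberField.discr K : ℚ)).analyticRank = 1 :=
      Literature.NumberTheory.EllipticCurves.analyticRank_eq_one_of_entireLFunction_one_eq_zero_of_deriv_ne_zero
        _ (hE _) hL0 hL1
    obtain ⟨hrk, hsha⟩ := hGZK' (W.quadraticTwist (NumberField.discr K : ℚ)) (le_of_eq hr1)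
    rw [hr1] at hrk
    haveI := hsha
    have hc' : (W.quadraticTwist (NumberField.discr K : ℚ)).selmerCorank 2 = 1 :=
      Literature.NumberTheory.EllipticCurves.selmerCorank_eq_one_of_mordellWeilRank_eq_one_of_finite
        (W.quadraticTwist (NumberField.discr K : ℚ)) 2 hrk inferInstance
    have htor := hT W hsur K hK
    obtain ⟨fW, hfW⟩ := hMod W
    obtain ⟨Dt⟩ :=
      Literature.NumberTheory.Automorphic.nonempty_modularParametrizationData_of_isNewformOf hfW
    obtain ⟨β, hβ⟩ := Literature.NumberTheory.EllipticCurves.exists_dvd_sq_sub_discr_holds (W.conductorNorm ℤ) K hK hHN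
    obtain ⟨ι⟩ := (inferInstance : Nonempty (K →+* ℂ))
    -- HNT|c1 on this corank-one frame (`0 + 1 = 1`), then Gross–Zagier over `K`
    obtain ⟨d₁, hd₁⟩ := hY W hCM hred hsur K hK hHN hodd hne3 htor hH2 Dt β ι hβ (by rw [hc, hc'])
    have hEK : Literature.NumberTheory.EllipticCurves.analyticRankEK W K = 1 :=
      analyticRankEK_eq_one_of_not_isOfFinAddOrder_derivedPoint_one (hGZ W _ K) (hrec _ W K) hK rfl hHN d₁ hd₁
    rw [Literature.NumberTheory.EllipticCurves.analyticRankEK_eq_add_of hE W K, hr1] at hEK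
    omega
  · -- ===== r = 1 : partner twist with L(E^{(d_K)}, 1) ≠ 0 (Hoffstein–Luo) =====
    have hw : W.rootNumber = -1 := by
      have h := hpar W
      unfold Literature.NumberTheory.EllipticCurves.p_parity at h
      rw [hc, pow_one] at h
      exact h.symm
    obtain ⟨K, _, _, hK, -, hHN, hH2, hd8, hL1⟩ :=
      Literature.NumberTheory.EllipticCurves.exists_heegnerField_split_twist_ne_zero_discr_emod_eight_of_hoffsteinLuo
        hmod hHL W hw Nat.prime_two 0
    have hodd : Odd (NumberField.discr K) := by
      rw [Int.odd_iff]; omega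
    have hne3 : NumberField.discr K ≠ -3 := by omega
    have hd : (NumberField.discr K : ℚ) ≠ 0 := by exact_mod_cast NumberField.discr_ne_zero K
    haveI := W.isElliptic_quadraticTwist hd
    obtain ⟨-, -, hfin⟩ := hKato (W.quadraticTwist (NumberField.discr K : ℚ)) hL1
    haveI := hfin
    have hc' : (W.quadraticTwist (NumberField.discr K : ℚ)).selmerCorank 2 = 0 :=
      (W.quadraticTwist (NumberField.discr K : ℚ)).selmerCorank_eq_zero_of_finite 2
    have htor := hT W hsur K hK
    obtain ⟨fW, hfW⟩ := hMod W
    obtain ⟨Dt⟩ :=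
      Literature.NumberTheory.Automorphic.nonempty_modularParametrizationData_of_isNewformOf hfW
    obtain ⟨β, hβ⟩ := Literature.NumberTheory.EllipticCurves.exists_dvd_sq_sub_discr_holds (W.conductorNorm ℤ) K hK hHN
    obtain ⟨ι⟩ := (inferInstance : Nonempty (K →+* ℂ))
    -- HNT|c1 on this corank-one frame (`1 + 0 = 1`), then Gross–Zagier over `K`
    obtain ⟨d₁, hd₁⟩ := hY W hCM hred hsur K hK hHN hodd hne3 htor hH2 Dt β ι hβ (by rw [hc, hc'])
    have hEK : Literature.NumberTheory.EllipticCurves.analyticRankEK W K = 1 :=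
      analyticRankEK_eq_one_of_not_isOfFinAddOrder_derivedPoint_one (hGZ W _ K) (hrec _ W K) hK rfl hHN d₁ hd₁
    rw [Literature.NumberTheory.EllipticCurves.analyticRankEK_eq_add_of hE W K,
      Literature.NumberTheory.EllipticCurves.analyticRank_eq_zero_of_entireLFunction_one_ne_zero _ hL1,
      add_zero] at hEK
    exact hEK

end ClosesReplay

/-! ## §5 Corollaries: the route's `closes` needs U1 / V1′∞ only on corank-one frames -/

/-- **KRR's deciding theorem needs V1′∞ only on the corank-one frames** (pen's `closes_of_corankOne`, re-derived): V1|c1 + V2♭∞ + the nine other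
hypotheses of `closes` ⟹ the leaf — by `heegnerNonTorsion_of_strongCorankOne` and `nonCMTwoConverse_of_heegnerNonTorsionCorankOne`.  Conditional on
OPEN items; closes nothing. [cite: Kolyvagin1991MathAnn, §2, Thm. 2.2] [cite: GrossZagier1986, I (6.1)] -/
theorem closes_of_corankOne (hV1 : KolyvaginStrongNonzeroSystemAtTwoCorankOne) (hV2 : KolyvaginCorankLowerBoundAtTwoRich)
    (hR : OffHabitatNonSurjTwoConverse) (hIn : PrintedInputsRankOneAtTwo) (hT : NoTwoTorsionOverK)
    (hf : BFHTwistSupply) (h0 : SimpleZeroTwistSplitAtTwoOfBFH) (hGZK : MultPublishedInputsAtTwo)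
    (hMod : NewformOfEllipticCurve) (hHLT : HoffsteinLuoNonvanishingTwist) (hEnt : EntireLFunctionRat) :
    Summit.BirchSwinnertonDyer.BirchSwinnertonDyer.Rank1Residual.NonCMTwoConverse :=
  nonCMTwoConverse_of_heegnerNonTorsionCorankOne (heegnerNonTorsion_of_strongCorankOne hV1 hV2) hR hIn hT hf h0 hGZK hMod hHLT hEnt

/-- **The route's own shape restricted**: U1|c1 + U2 + V2♭∞ + the nine other hypotheses of `closes` ⟹ the leaf.  So for `closes` the item U1
(stmt-28083) may be replaced by its corank-one restriction.  Conditional on OPEN items; closes nothing; BSD is not proved.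
[cite: Kolyvagin1991MathAnn, §2 (2.1), Conj. 2.5, Thm. 2.2] [cite: GrossZagier1986, I (6.1)] -/
theorem nonCMTwoConverse_of_boundedDefectCorankOne (hU1 : KolyvaginBoundedDefectAtTwoCorankOne) (hU2 : FullClassDeepeningAtTwo)
    (hV2 : KolyvaginCorankLowerBoundAtTwoRich)
    (hR : OffHabitatNonSurjTwoConverse) (hIn : PrintedInputsRankOneAtTwo) (hT : NoTwoTorsionOverK)
    (hf : BFHTwistSupply) (h0 : SimpleZeroTwistSplitAtTwoOfBFH) (hGZK : MultPublishedInputsAtTwo)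
    (hMod : NewformOfEllipticCurve) (hHLT : HoffsteinLuoNonvanishingTwist) (hEnt : EntireLFunctionRat) :
    Summit.BirchSwinnertonDyer.BirchSwinnertonDyer.Rank1Residual.NonCMTwoConverse :=
  closes_of_corankOne (strongCorankOne_of_boundedDefectCorankOne hU1 hU2) hV2 hR hIn hT hf h0 hGZK hMod hHLT hEnt

/-- **Sanity link with the route as filed**: U1 + U2 + V2♭∞ + … ⟹ the leaf through the corank-one door (the route's `closes` composed with
LINE 14's glue gives the same; this records that the door loses nothing `closes` uses).  Conditional on OPEN items; closes nothing.
[cite: Kolyvagin1991MathAnn, §2 (2.1), Conj. 2.5, Thm. 2.2] -/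
theorem nonCMTwoConverse_of_boundedDefect (hU1 : KolyvaginBoundedDefectAtTwo) (hU2 : FullClassDeepeningAtTwo)
    (hV2 : KolyvaginCorankLowerBoundAtTwoRich)
    (hR : OffHabitatNonSurjTwoConverse) (hIn : PrintedInputsRankOneAtTwo) (hT : NoTwoTorsionOverK)
    (hf : BFHTwistSupply) (h0 : SimpleZeroTwistSplitAtTwoOfBFH) (hGZK : MultPublishedInputsAtTwo)
    (hMod : NewformOfEllipticCurve) (hHLT : HoffsteinLuoNonvanishingTwist) (hEnt : EntireLFunctionRat) :
    Summit.BirchSwinnertonDyer.BirchSwinnertonDyer.Rank1Residual.NonCMTwoConverse :=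
  nonCMTwoConverse_of_boundedDefectCorankOne (corankOne_of_boundedDefect hU1) hU2 hV2 hR hIn hT hf h0 hGZK hMod hHLT hEnt

end Summit.BirchSwinnertonDyer.BirchSwinnertonDyer.Theorems.KolyvaginAtTwo.CorankOne
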